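import Summits.Schanuel.Schanuel.Theorems.RootDecomp1KHyper17

/-!
# RootDecomp1KDarkResultant — §19 «DarkCarving» port, part 1/4 (lens 6, gen 10 = ROUND 5 theorem round of route-Schanuel-RootDecomp1K on A₄ʰ stmt-Schanuel-33363)

Mechanical port (census-1 gen 8; tools tools/build_dark.py over census/tools/gen7/portkit2.py) of §19 of HOME/decomp-schanuel-lens-6/g10/DarkCarving.lean
(sha256 8f91770b…, 9205 l; critic VERDICT 2026-08-30T15:10:09Z ACCEPTED — THEOREM ROUND, PATH T, census C-2) on top of the §17 wave Theorems/RootDecomp1KHyper01…19.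
This part: node lines 8089–8292 (23 declarations: norm_aeval_le_len_mul_pow, exists_lipschitz_at_croot, exists_lipschitz_at, conjFactor, sliceAt, relHat …).
The node-local named fact `NW1996Thm1` is replaced by the registered Literature fact
`Literature.NumberTheory.Transcendental.NesterenkoWaldschmidt1996_thm_1` (token-identical body); statements and proofs
are otherwise the node's verbatim, in the wave namespace `Summit.Schanuel.Schanuel.Theorems.RootDecomp1KHyper` (sub-namespace `HyperCell`).
`--supports stmt-Schanuel-33363` (A₄ʰ HyperLiouvilleSchanuel: levels n ≤ 2 decided mod NW96 Thm 1 alone). Sorry-free; standard axioms. Nothing here proves Schanuel; rung 0.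
-/

set_option linter.dupNamespace false
set_option linter.unusedSectionVars false

noncomputable section

open Complex IntermediateField Filter Polynomial

namespace Summit.Schanuel.Schanuel.Theorems.RootDecomp1KHyper

variable {n K : ℕ}

namespace HyperCell

variable {n K : ℕ}

/-- `‖G(b)‖ ≤ len(G) · max(1,‖b‖)^N` for `natDegree G ≤ N`. -/
theorem norm_aeval_le_len_mul_pow (G : ℤ[X]) {N : ℕ} (hN : G.natDegree ≤ N) (b : ℂ) :
    ‖aeval b G‖ ≤ (len G : ℝ) * max 1 ‖b‖ ^ N := by
  have hm1 : (1 : ℝ) ≤ max 1 ‖b‖ := le_max_left _ _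
  rw [Polynomial.aeval_eq_sum_range, len]
  push_cast
  refine (norm_sum_le _ _).trans ?_
  rw [Finset.sum_mul]
  refine Finset.sum_le_sum fun j hj => ?_
  have hj' : j ≤ N := by
    have := Finset.mem_range.mp hj; omega
  rw [zsmul_eq_mul, norm_mul, Complex.norm_intCast, norm_pow]
  refine mul_le_mul_of_nonneg_left ?_ (abs_nonneg _)
  calc ‖b‖ ^ j ≤ (max 1 ‖b‖) ^ j := pow_le_pow_left₀ (norm_nonneg _) (le_max_right _ _) j
    _ ≤ (max 1 ‖b‖) ^ N := pow_le_pow_right₀ hm1 hj'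

/-- Complex Lipschitz bound at a root: `‖μ(z)‖ ≤ M ‖z − w‖` for `‖z − w‖ ≤ 1`, if `μ(w) = 0`. -/
theorem exists_lipschitz_at_croot (μ : ℂ[X]) (w : ℂ) (hroot : μ.eval w = 0) :
    ∃ M : ℝ, 1 ≤ M ∧ ∀ z : ℂ, ‖z - w‖ ≤ 1 → ‖μ.eval z‖ ≤ M * ‖z - w‖ := by
  set ν := μ /ₘ (X - C w) with hν
  have hdvd : (X - C w) * ν = μ := Polynomial.mul_divByMonic_eq_iff_isRoot.mpr hroot
  obtain ⟨M₀, hM₀⟩ := (isCompact_closedBall w 1).exists_bound_of_continuousOn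
    (Polynomial.continuous ν).continuousOn
  refine ⟨max M₀ 0 + 1, by linarith [le_max_right M₀ 0], fun z hz => ?_⟩
  have hmem : z ∈ Metric.closedBall w 1 := by
    rw [Metric.mem_closedBall, Complex.dist_eq]; exact hz
  have h1 : μ.eval z = (z - w) * ν.eval z := by
    conv_lhs => rw [← hdvd]
    rw [eval_mul, eval_sub, eval_X, eval_C]
  rw [h1, norm_mul]
  calc ‖z - w‖ * ‖ν.eval z‖ ≤ ‖z - w‖ * M₀ := by gcongr; exact hM₀ _ hmem
    _ ≤ ‖z - w‖ * (max M₀ 0 + 1) := by gcongr; linarith [le_max_left M₀ 0]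
    _ = (max M₀ 0 + 1) * ‖z - w‖ := mul_comm _ _

/-- Complex Lipschitz bound: `‖μ(z) − μ(w)‖ ≤ M ‖z − w‖` for `‖z − w‖ ≤ 1`. -/
theorem exists_lipschitz_at (μ : ℂ[X]) (w : ℂ) :
    ∃ M : ℝ, 1 ≤ M ∧ ∀ z : ℂ, ‖z - w‖ ≤ 1 → ‖μ.eval z - μ.eval w‖ ≤ M * ‖z - w‖ := by
  obtain ⟨M, hM, h⟩ := exists_lipschitz_at_croot (μ - C (μ.eval w)) w (by simp)
  refine ⟨M, hM, fun z hz => ?_⟩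
  have := h z hz
  rwa [eval_sub, eval_C] at this

/-- The conjugate factor `Q(b, Y) = Σ_k G_k(b) Y^k ∈ ℂ[Y]`. -/
def conjFactor (G : Fin (K + 1) → ℤ[X]) (b : ℂ) : ℂ[X] :=
  ∑ k : Fin (K + 1), C (aeval b (G k)) * X ^ (k : ℕ)

/-- The slice `Q(X, y) = Σ_k y^k G_k(X) ∈ ℂ[X]` (polynomial in the `t`-variable). -/
def sliceAt (G : Fin (K + 1) → ℤ[X]) (y : ℂ) : ℂ[X] :=
  ∑ k : Fin (K + 1), C (y ^ (k : ℕ)) * (G k).map (Int.castRingHom ℂ)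

/-- The bivariate relation polynomial `Q̂ = Σ_k C(Y^k) · Ĝ_k ∈ (ℤ[Y])[X]`. -/
def relHat (G : Fin (K + 1) → ℤ[X]) : Polynomial (Polynomial ℤ) :=
  ∑ k : Fin (K + 1), C (X ^ (k : ℕ)) * (G k).map (C : ℤ →+* ℤ[X])

/-- The eliminant `S = Res_X(f̂, Q̂) ∈ ℤ[Y]`. -/
def resPoly (f : ℤ[X]) (G : Fin (K + 1) → ℤ[X]) (N : ℕ) : ℤ[X] :=
  Polynomial.resultant (f.map (C : ℤ →+* ℤ[X])) (relHat G) f.natDegree N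

/-- §19b. The resultant eliminating t: an integer polynomial vanishing at α: auxiliary statement `eval_conjFactor` (lens 6 gen 10 node, ported verbatim). -/
theorem eval_conjFactor (G : Fin (K + 1) → ℤ[X]) (b y : ℂ) :
    (conjFactor G b).eval y = ∑ k : Fin (K + 1), aeval b (G k) * y ^ (k : ℕ) := by
  simp [conjFactor, eval_finsetSum]

/-- §19b. The resultant eliminating t: an integer polynomial vanishing at α: auxiliary statement `eval_sliceAt` (lens 6 gen 10 node, ported verbatim). -/
theorem eval_sliceAt (G : Fin (K + 1) → ℤ[X]) (y b : ℂ) :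
    (sliceAt G y).eval b = ∑ k : Fin (K + 1), aeval b (G k) * y ^ (k : ℕ) := by
  simp only [sliceAt, eval_finsetSum, eval_mul, eval_C, eval_map]
  refine Finset.sum_congr rfl fun k _ => ?_
  rw [mul_comm]
  rfl

/-- §19b. The resultant eliminating t: an integer polynomial vanishing at α: auxiliary statement `natDegree_conjFactor_le` (lens 6 gen 10 node, ported verbatim). -/
theorem natDegree_conjFactor_le (G : Fin (K + 1) → ℤ[X]) (b : ℂ) :
    (conjFactor G b).natDegree ≤ K := by
  unfold conjFactor
  refine natDegree_sum_le_of_forall_le _ _ fun k _ => ?_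
  refine (natDegree_C_mul_le _ _).trans ?_
  rw [natDegree_X_pow]
  exact Nat.lt_succ_iff.mp k.2

/-- §19b. The resultant eliminating t: an integer polynomial vanishing at α: auxiliary statement `coeff_conjFactor` (lens 6 gen 10 node, ported verbatim). -/
theorem coeff_conjFactor (G : Fin (K + 1) → ℤ[X]) (b : ℂ) (k : Fin (K + 1)) :
    (conjFactor G b).coeff (k : ℕ) = aeval b (G k) := by
  unfold conjFactor
  rw [finsetSum_coeff]
  simp only [coeff_C_mul, coeff_X_pow]
  rw [Finset.sum_eq_single k]
  · simp
  · intro j _ hjk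
    rw [if_neg]; · simp
    intro h; exact hjk (Fin.ext h.symm)
  · intro h; exact absurd (Finset.mem_univ k) h

/-- §19b. The resultant eliminating t: an integer polynomial vanishing at α: auxiliary statement `natDegree_sliceAt_le` (lens 6 gen 10 node, ported verbatim). -/
theorem natDegree_sliceAt_le (G : Fin (K + 1) → ℤ[X]) (y : ℂ) {N : ℕ}
    (hN : ∀ k, (G k).natDegree ≤ N) : (sliceAt G y).natDegree ≤ N := by
  unfold sliceAt
  refine natDegree_sum_le_of_forall_le _ _ fun k _ => ?_
  exact (natDegree_C_mul_le _ _).trans (natDegree_map_le.trans (hN k))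

/-- §19b. The resultant eliminating t: an integer polynomial vanishing at α: auxiliary statement `natDegree_relHat_le` (lens 6 gen 10 node, ported verbatim). -/
theorem natDegree_relHat_le (G : Fin (K + 1) → ℤ[X]) {N : ℕ}
    (hN : ∀ k, (G k).natDegree ≤ N) : (relHat G).natDegree ≤ N := by
  unfold relHat
  refine natDegree_sum_le_of_forall_le _ _ fun k _ => ?_
  exact (natDegree_C_mul_le _ _).trans (natDegree_map_le.trans (hN k))

/-- The evaluation `ℤ[Y] → ℂ` at `y`. -/
def evC (y : ℂ) : ℤ[X] →+* ℂ := Polynomial.eval₂RingHom (Int.castRingHom ℂ) y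

/-- §19b. The resultant eliminating t: an integer polynomial vanishing at α: auxiliary statement `evC_apply` (lens 6 gen 10 node, ported verbatim). -/
theorem evC_apply (y : ℂ) (S : ℤ[X]) : evC y S = aeval y S := by
  rw [evC, coe_eval₂RingHom, aeval_def, algebraMap_int_eq]

/-- §19b. The resultant eliminating t: an integer polynomial vanishing at α: auxiliary statement `evC_comp_C` (lens 6 gen 10 node, ported verbatim). -/
theorem evC_comp_C (y : ℂ) : (evC y).comp (C : ℤ →+* ℤ[X]) = Int.castRingHom ℂ := by
  ext n
  simp [evC]

/-- §19b. The resultant eliminating t: an integer polynomial vanishing at α: auxiliary statement `map_relHat_evC` (lens 6 gen 10 node, ported verbatim). -/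
theorem map_relHat_evC (G : Fin (K + 1) → ℤ[X]) (y : ℂ) :
    (relHat G).map (evC y) = sliceAt G y := by
  unfold relHat sliceAt
  rw [Polynomial.map_sum]
  refine Finset.sum_congr rfl fun k _ => ?_
  rw [Polynomial.map_mul, Polynomial.map_C, Polynomial.map_map, evC_comp_C]
  congr 2
  simp [evC]

/-- **Specialisation of the eliminant**: `S(y) = lc(f)^N · ∏_{b : f(b) = 0} Q(b, y)`. -/
theorem aeval_resPoly (f : ℤ[X]) (G : Fin (K + 1) → ℤ[X]) {N : ℕ}
    (hN : ∀ k, (G k).natDegree ≤ N) (y : ℂ) :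
    aeval y (resPoly f G N) =
      (f.map (Int.castRingHom ℂ)).leadingCoeff ^ N *
        ((f.map (Int.castRingHom ℂ)).roots.map fun b => (conjFactor G b).eval y).prod := by
  rw [← evC_apply, resPoly, ← Polynomial.resultant_map_map, Polynomial.map_map, evC_comp_C,
    map_relHat_evC]
  have hdeg : (f.map (Int.castRingHom ℂ)).natDegree = f.natDegree :=
    natDegree_map_eq_of_injective (RingHom.injective_int _) f
  rw [← hdeg, Polynomial.resultant_eq_prod_eval _ _ N (natDegree_sliceAt_le G y hN)
    (IsAlgClosed.splits _)]
  congr 1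
  refine congrArg Multiset.prod (Multiset.map_congr rfl fun b _ => ?_)
  rw [eval_sliceAt, eval_conjFactor]

/-- **The eliminant as a product over conjugates** (identity in `ℂ[Y]`). -/
theorem map_resPoly (f : ℤ[X]) (G : Fin (K + 1) → ℤ[X]) {N : ℕ}
    (hN : ∀ k, (G k).natDegree ≤ N) :
    (resPoly f G N).map (Int.castRingHom ℂ) =
      C ((f.map (Int.castRingHom ℂ)).leadingCoeff ^ N) *
        ((f.map (Int.castRingHom ℂ)).roots.map (conjFactor G)).prod := by
  apply Polynomial.funext
  intro y
  rw [eval_map, ← algebraMap_int_eq, ← aeval_def, aeval_resPoly f G hN y, eval_mul, eval_C,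
    eval_multiset_prod, Multiset.map_map]
  rfl

/-- `S(α) = 0` if `f(β) = 0` and `Q(β, α) = 0`. -/
theorem aeval_resPoly_eq_zero (f : ℤ[X]) (hf : f ≠ 0) (G : Fin (K + 1) → ℤ[X]) {N : ℕ}
    (hN : ∀ k, (G k).natDegree ≤ N) {α β : ℂ} (hβ : aeval β f = 0)
    (hα : (conjFactor G β).eval α = 0) : aeval α (resPoly f G N) = 0 := by
  rw [aeval_resPoly f G hN α]
  have hmem : β ∈ (f.map (Int.castRingHom ℂ)).roots := by
    rw [mem_roots ((Polynomial.map_ne_zero_iff (RingHom.injective_int _)).mpr hf), IsRoot.def,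
      eval_map, ← algebraMap_int_eq, ← aeval_def]
    exact hβ
  have h0 : ((f.map (Int.castRingHom ℂ)).roots.map fun b => (conjFactor G b).eval α).prod = 0 := by
    apply Multiset.prod_eq_zero
    exact Multiset.mem_map.mpr ⟨β, hmem, hα⟩
  rw [h0, mul_zero]

/-- §19b. The resultant eliminating t: an integer polynomial vanishing at α: auxiliary statement `conjFactor_ne_zero` (lens 6 gen 10 node, ported verbatim). -/
theorem conjFactor_ne_zero (G : Fin (K + 1) → ℤ[X]) {b : ℂ} (hb : aeval b (G (Fin.last K)) ≠ 0) :
    conjFactor G b ≠ 0 := by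
  intro h
  have := coeff_conjFactor G b (Fin.last K)
  rw [h, coeff_zero] at this
  exact hb this.symm

/-- `S ≠ 0` as soon as the top coefficient `G_K` vanishes at no conjugate of `β`. -/
theorem resPoly_ne_zero (f : ℤ[X]) (hf : f ≠ 0) (G : Fin (K + 1) → ℤ[X]) {N : ℕ}
    (hN : ∀ k, (G k).natDegree ≤ N)
    (htop : ∀ b ∈ (f.map (Int.castRingHom ℂ)).roots, aeval b (G (Fin.last K)) ≠ 0) :
    resPoly f G N ≠ 0 := by
  intro h0
  have h := map_resPoly f G hN
  rw [h0, Polynomial.map_zero] at h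
  have hlc : (f.map (Int.castRingHom ℂ)).leadingCoeff ^ N ≠ 0 :=
    pow_ne_zero _ (leadingCoeff_ne_zero.mpr
      ((Polynomial.map_ne_zero_iff (RingHom.injective_int _)).mpr hf))
  have hprod : ((f.map (Int.castRingHom ℂ)).roots.map (conjFactor G)).prod ≠ 0 := by
    apply Multiset.prod_ne_zero
    intro hmem
    obtain ⟨b, hb, hb0⟩ := Multiset.mem_map.mp hmem
    exact conjFactor_ne_zero G (htop b hb) hb0
  exact (mul_ne_zero (C_ne_zero.mpr hlc) hprod) h.symm

/-- `deg S ≤ deg f · K`. -/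
theorem natDegree_resPoly_le (f : ℤ[X]) (G : Fin (K + 1) → ℤ[X]) {N : ℕ}
    (hN : ∀ k, (G k).natDegree ≤ N) : (resPoly f G N).natDegree ≤ f.natDegree * K := by
  rw [← natDegree_map_eq_of_injective ((Int.castRingHom ℂ).injective_int) (resPoly f G N), map_resPoly f G hN]
  refine (natDegree_C_mul_le _ _).trans ?_
  refine (natDegree_multiset_prod_le _).trans ?_
  rw [Multiset.map_map]
  have hcard : Multiset.card (f.map (Int.castRingHom ℂ)).roots ≤ f.natDegree :=
    (card_roots' _).trans natDegree_map_le
  calc (Multiset.map (natDegree ∘ conjFactor G) (f.map (Int.castRingHom ℂ)).roots).sum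
      ≤ (Multiset.map (fun _ => K) (f.map (Int.castRingHom ℂ)).roots).sum :=
        Multiset.sum_map_le_sum_map _ _ fun b _ => natDegree_conjFactor_le G b
    _ = Multiset.card (f.map (Int.castRingHom ℂ)).roots * K := by
        rw [Multiset.map_const', Multiset.sum_replicate, smul_eq_mul]
    _ ≤ f.natDegree * K := Nat.mul_le_mul_right K hcard

end HyperCell

end Summit.Schanuel.Schanuel.Theorems.RootDecomp1KHyper
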